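import Summits.QuantumFields.YangMills.Theorems.FluctuationComparisonRegPrIntLHaarTubeOneStep
import HarnessLib

/-!
# `FluctuationComparisonRegPrIntLHaarTubeOneStepCompact` — the COMPACTNESS PATCH for ⟨HAAR-TUBE₁⟩'s chart door: datum-dependent tube fractions at every
# point of a compact set of data give ONE fraction (crux `FluctuationComparisonRegPrIntL`, stmt-QuantumFields-20520; LINE g22-4 ∕ g22-5 ∕ g22-6, row TUBE∘)

Cell `ym3-torus` (YM ladder rung R3 = continuum SU(2) Yang–Mills on T³ — a RUNG, NOT d = 4, NOT infinite volume, NOT a mass gap, NOT Clay);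
width seat `ym3-torus-px8` (gen 14), explicit-unit helper; `--supports stmt-QuantumFields-20520 --as helper`.  THEOREMS ONLY (0 `def`, 0 `sorry`,
default heartbeats).  Sibling of ✓`…HaarTubeOneStep` (p764111; kept apart by the 400-line cap).

WHAT.  ★★ `haarTube_oneStep_of_windowCharts_compact` — the lower twin of px20 g10's local-to-global patch, asked by LEAD w3-20520 g18 (06:32:47Z): `Sfine`
measurable, `W` open, `K` compact, `σ` ANY function, radius `r`; if every `U₀ ∈ K` has a window chart `c : WindowChart F (Nat.le_succ J) Sfine O` over an open
`O ∋ U₀` and a fraction `q₀(U₀) > 0` with the fibrewise tube letter `dU_J`-a.e. on `O ∩ W`, then ONE `q > 0` serves every measurable `B ⊆ W ∩ K`: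
`ofReal q·dU_{J+1}(D⁻¹B ∩ Sfine) ≤ dU_{J+1}(D⁻¹B ∩ Sfine ∩ T_σ)` (finite subcover `IsCompact.elim_nhds_subcover'`, `q := min`, then ✓`haarTube_oneStep_of_windowCharts`
on the open set `W ∩ ⋃ O`).  Intended use: `K` = the CLOSED level-`J` window `{plaq ≤ θ_J(c·b₀)}`, `W` = an open window carrying the charts.

HONEST SCOPE.  Bookkeeping; the fibrewise letter is the hypothesis; ⟨HAAR-TUBE₁⟩'s letter, ⟨SMALL-MASS₁⟩, ⟨UP⟩, ⟨LOW⟩, TUBE∘, PERS₁∘, 20520 and every rung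
statement are NOT proved; `YM3TorusSU2` NOT proved; the Yang–Mills mass gap (Clay) NOT proved.

References: T. Bałaban, Commun. Math. Phys. **98** (1985) 17–51 [Balaban1985Averaging] ((10) p. 19, Prop. 1 p. 22); CMP **109** (1987) 249–301
[Balaban1987RG1] ((0.4) p. 253, (2.10) p. 267).
-/

set_option autoImplicit false

noncomputable section

open MeasureTheory Set
open scoped ENNReal NNReal
open Literature.MathematicalPhysics.QuantumFieldTheory.Balaban1983to89
open Literature.MathematicalPhysics.QuantumFieldTheory.Balaban1983to89.T3ContinuumYM3Torus
open Literature.MathematicalPhysics.QuantumFieldTheory.Balaban1983to89.T3UnitLawDensityEML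
open Literature.MathematicalPhysics.QuantumFieldTheory.Balaban1983to89.T3TiltDescent
open scoped Literature.MathematicalPhysics.QuantumFieldTheory.Balaban1983to89.T3OrbitAverage
open Summit.QuantumFields.YangMills.Theorems.FluctuationComparisonRegPrIntLWregGlue (WindowChart)
open Summit.QuantumFields.YangMills.Theorems.FluctuationComparisonRegPrIntLHaarTubeOneStep (haarTube_oneStep_of_windowCharts)

namespace Summit.QuantumFields.YangMills.Theorems.FluctuationComparisonRegPrIntLHaarTubeOneStepCompact

/-! ## §1 The compactness patch: charts with datum-dependent fractions over a compact set of data -/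

section Compact

variable (F : T3Family) {J : ℕ}

/-- ★★ **FINITE SUBCOVER, `q := min`** (the lower twin of the local-to-global patch): `Sfine` measurable, `W` open, `K` compact, `σ` ANY function, radius `r`.
If every `U₀ ∈ K` has a window chart `c : WindowChart F (Nat.le_succ J) Sfine O` over an open `O ∋ U₀` and a fraction `q₀(U₀) > 0` such that the Haar
fibres charge the `r`-link-tube around `σ U` with fraction `q₀(U₀)` for `dU_J`-a.e. `U ∈ O ∩ W`, then ONE fraction `q > 0` serves every measurable
`B ⊆ W ∩ K`: `ofReal q·dU_{J+1}(D⁻¹B ∩ Sfine) ≤ dU_{J+1}(D⁻¹B ∩ Sfine ∩ T_σ)` (finite subcover of `K` by chart domains, `q :=` the least of the finitely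
many `q₀` and `1`, then §4 on the open set `W ∩ ⋃ O`).  Intended use: `K` = the CLOSED level-`J` window, `W` = a slightly larger open window carrying the charts.
[cite: Balaban1985Averaging, (10) p.19 and Prop. 1 p.22; Balaban1987RG1, (0.4) p.253 and (2.10) p.267] -/
theorem haarTube_oneStep_of_windowCharts_compact
    {Sfine : Set (GaugeField (F.P (J + 1)) 0 (Matrix.specialUnitaryGroup (Fin 2) ℂ))} (hS : MeasurableSet Sfine)
    {W : Set (GaugeField (F.P J) 0 (Matrix.specialUnitaryGroup (Fin 2) ℂ))} (hW : IsOpen W)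
    {K : Set (GaugeField (F.P J) 0 (Matrix.specialUnitaryGroup (Fin 2) ℂ))} (hK : IsCompact K)
    (σ : GaugeField (F.P J) 0 (Matrix.specialUnitaryGroup (Fin 2) ℂ) → GaugeField (F.P (J + 1)) 0 (Matrix.specialUnitaryGroup (Fin 2) ℂ))
    (r : ℝ)
    (h : ∀ U₀ ∈ K, ∃ (O : Set (GaugeField (F.P J) 0 (Matrix.specialUnitaryGroup (Fin 2) ℂ)))
        (c : WindowChart F (Nat.le_succ J) Sfine O) (q₀ : ℝ), IsOpen O ∧ U₀ ∈ O ∧ 0 < q₀ ∧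
        ∀ᵐ U ∂(fieldMeasure (F.P J) 0 (Matrix.specialUnitaryGroup (Fin 2) ℂ)), U ∈ O ∩ W →
          ENNReal.ofReal q₀ * ∫⁻ z, (c.jac (U, z) : ℝ≥0∞) ∂(fieldMeasure (F.P (J + 1)) 0 (Matrix.specialUnitaryGroup (Fin 2) ℂ)) ≤
            ∫⁻ z, {V : GaugeField (F.P (J + 1)) 0 (Matrix.specialUnitaryGroup (Fin 2) ℂ) |
                ∀ b : PBond (F.P (J + 1)) 0, dist1 ((σ U b)⁻¹ * V b) < r}.indicator (fun _ => (1 : ℝ≥0∞)) (c.Φ (U, z)) *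
              (c.jac (U, z) : ℝ≥0∞) ∂(fieldMeasure (F.P (J + 1)) 0 (Matrix.specialUnitaryGroup (Fin 2) ℂ))) :
    ∃ q : ℝ, 0 < q ∧ ∀ B : Set (GaugeField (F.P J) 0 (Matrix.specialUnitaryGroup (Fin 2) ℂ)), MeasurableSet B → B ⊆ W → B ⊆ K →
      ENNReal.ofReal q * fieldMeasure (F.P (J + 1)) 0 (Matrix.specialUnitaryGroup (Fin 2) ℂ)
          (descendTo F ℰp J (J + 1) (Nat.le_succ J) ⁻¹' B ∩ Sfine) ≤
        fieldMeasure (F.P (J + 1)) 0 (Matrix.specialUnitaryGroup (Fin 2) ℂ)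
          (descendTo F ℰp J (J + 1) (Nat.le_succ J) ⁻¹' B ∩ Sfine ∩
            {V | ∀ b : PBond (F.P (J + 1)) 0, dist1 ((σ (descendTo F ℰp J (J + 1) (Nat.le_succ J) V) b)⁻¹ * V b) < r}) := by
  classical
  choose O c q₀ hO hU₀O hq₀ hfib using h
  -- a finite subcover of `K` by chart domains
  obtain ⟨t, hcover⟩ := hK.elim_nhds_subcover' (fun U₀ hU₀ => O U₀ hU₀) fun U₀ hU₀ => (hO U₀ hU₀).mem_nhds (hU₀O U₀ hU₀)
  -- the least of the finitely many fractions (and `1`)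
  set qs : Finset ℝ := insert 1 (t.image fun x : ↥K => q₀ x.1 x.2) with hqs_def
  have hne : qs.Nonempty := Finset.insert_nonempty _ _
  have hqpos : 0 < qs.min' hne := by
    refine (Finset.lt_min'_iff qs hne).mpr fun y hy => ?_
    rcases Finset.mem_insert.mp hy with rfl | hy
    · norm_num
    · obtain ⟨x, -, rfl⟩ := Finset.mem_image.mp hy
      exact hq₀ _ _
  have hqle : ∀ x ∈ t, qs.min' hne ≤ q₀ x.1 x.2 := fun x hx =>
    Finset.min'_le _ _ (Finset.mem_insert_of_mem (Finset.mem_image_of_mem (fun x : ↥K => q₀ x.1 x.2) hx))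
  -- the open set carrying the charts
  set W' : Set (GaugeField (F.P J) 0 (Matrix.specialUnitaryGroup (Fin 2) ℂ)) :=
    W ∩ ⋃ x ∈ t, O x.1 x.2 with hW'_def
  have hW' : IsOpen W' := hW.inter (isOpen_biUnion fun x _ => hO x.1 x.2)
  refine ⟨qs.min' hne, hqpos, fun B hB hBW hBK => ?_⟩
  have hBW' : B ⊆ W' := fun U hU => ⟨hBW hU, hcover (hBK hU)⟩
  refine haarTube_oneStep_of_windowCharts F hS hW' σ r (q := qs.min' hne) (fun U₀ hU₀ => ?_) B hB hBW'
  obtain ⟨x, hx, hU₀x⟩ := Set.mem_iUnion₂.mp hU₀.2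
  refine ⟨O x.1 x.2, c x.1 x.2, hO x.1 x.2, hU₀x, ?_⟩
  filter_upwards [hfib x.1 x.2] with U hU hUOW'
  have h1 := hU ⟨hUOW'.1, hUOW'.2.1⟩
  exact le_trans (mul_le_mul_left (ENNReal.ofReal_le_ofReal (hqle x hx)) _) h1

end Compact

end Summit.QuantumFields.YangMills.Theorems.FluctuationComparisonRegPrIntLHaarTubeOneStepCompact

end
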